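import Summits.HodgeConjecture.HodgeConjecture.Theses.ELineTransport
import Summits.HodgeConjecture.HodgeConjecture.Theorems.NikulinTwinTransportTwinTwistorTransportTwistorReachAlgebra

/-!
# Route `ELineTransport` — support item `ELineConnectivityR` (stmt-HodgeConjecture-13981), part 1:
# the real K3 form `D = diag(1,1,1,-1,…,-1)` on `ℝ²²`, orthogonal complements of positive 3-planes,
# and the transfer map between two positive 3-planes

Elementary bilinear algebra for the proof of `Theses.ELineTransport.ELineConnectivityR`
(generic E-twistor connectivity).  Everything is stated for the real bilinear form
`B = Matrix.toBilin' D`, `D = Matrix.diagonal (fun i : Fin 22 => if i.val < 3 then 1 else -1)`,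
which is the statement's `q v w = v ⬝ᵥ (D *ᵥ w)`.

Contents (the algebra of positive triples for a symmetric form on any real vector space is
reused from `Theorems.NikulinTwinTransportTwinTwistorTransportTwistorReachAlgebra`):
* `B` is symmetric and nondegenerate; `B v w = v ⬝ᵥ (D *ᵥ w)`;
* the KEY SIGNATURE FACT: the `B`-orthogonal complement of a positive definite `3`-plane `W` is
  NEGATIVE definite (the positive index of `D` is `3`: a `4`-space on which `B ≥ 0` would meet the
  `19`-space `{v₀ = v₁ = v₂ = 0}`, where `B < 0`), hence complementary to every positive `3`-plane;
* the TRANSFER MAP: for positive `3`-planes `W₀, W₁` the projection `π` of `ℝ²²` onto `W₁` along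
  `W₀ᗮ` restricts to a linear bijection `W₀ → W₁` with `π w - w ∈ W₀ᗮ`.
No definitions, no named facts, no sorry.
-/

-- `Summit.HodgeConjecture.HodgeConjecture.…` (summit = problem) duplicates a namespace component by design (D-0017).
set_option linter.dupNamespace false

noncomputable section

open Matrix Module

namespace Summit.HodgeConjecture.HodgeConjecture.Theorems

namespace ELineConnR

/-! ### Positive definite subspaces and their orthogonal complements (any real vector space)

The algebra of positive triples (`twistorV_comb2`, `twistorV_comb3`, `twistorV_linearIndependent`,
`twistorV_finrank_span`, `twistorV_pos_of_mem_span`) is imported from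
`Theorems.NikulinTwinTransportTwinTwistorTransportTwistorReachAlgebra`. -/

section General

variable {V : Type*} [AddCommGroup V] [Module ℝ V]

/-- A positive definite subspace meets its orthogonal complement trivially, hence (reflexive form,
finite dimension) the two are complementary. [folklore] -/
theorem isCompl_orthogonal_of_posDef [FiniteDimensional ℝ V] (B : LinearMap.BilinForm ℝ V)
    (hBs : ∀ u w, B u w = B w u) {W : Submodule ℝ V} (hW : ∀ u ∈ W, u ≠ 0 → 0 < B u u) :
    IsCompl W (B.orthogonal W) := by
  have hB₀ : B.IsRefl := fun u w h => by rw [hBs]; exact h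
  rw [LinearMap.BilinForm.isCompl_orthogonal_iff_disjoint hB₀, Submodule.disjoint_def]
  intro u hu hu'
  by_contra h0
  have h1 := hW u hu h0
  have h2 : B u u = 0 := (LinearMap.BilinForm.mem_orthogonal_iff.1 hu') u hu
  exact h1.ne' h2

end General

/-! ### The real K3 form `B = toBilin' D` on `ℝ²²` -/

/-- Unfolding of the real form: `B v w = Σᵢ dᵢ vᵢ wᵢ`. [folklore] -/
theorem form_apply (v w : Fin 22 → ℝ) :
    Matrix.toBilin' (Matrix.diagonal (fun i : Fin 22 => if i.val < 3 then (1 : ℝ) else -1)) v w =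
      ∑ i, (if i.val < 3 then (1 : ℝ) else -1) * v i * w i := by
  rw [Matrix.toBilin'_apply']
  simp only [Matrix.mulVec_diagonal, dotProduct]
  refine Finset.sum_congr rfl fun i _ => ?_
  ring

/-- The real form is the statement's `q v w = v ⬝ᵥ (D *ᵥ w)`. [folklore] -/
theorem form_eq_dotProduct (v w : Fin 22 → ℝ) :
    Matrix.toBilin' (Matrix.diagonal (fun i : Fin 22 => if i.val < 3 then (1 : ℝ) else -1)) v w =
      v ⬝ᵥ ((Matrix.diagonal (fun i : Fin 22 => if i.val < 3 then (1 : ℝ) else -1)) *ᵥ w) := by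
  rw [Matrix.toBilin'_apply']

/-- The real form is symmetric. [folklore] -/
theorem form_comm (v w : Fin 22 → ℝ) :
    Matrix.toBilin' (Matrix.diagonal (fun i : Fin 22 => if i.val < 3 then (1 : ℝ) else -1)) v w =
      Matrix.toBilin' (Matrix.diagonal (fun i : Fin 22 => if i.val < 3 then (1 : ℝ) else -1))
        w v := by
  rw [form_apply, form_apply]
  refine Finset.sum_congr rfl fun i _ => ?_
  ring

/-- The real form is reflexive. [folklore] -/
theorem form_isRefl :
    (Matrix.toBilin' (Matrix.diagonal
      (fun i : Fin 22 => if i.val < 3 then (1 : ℝ) else -1))).IsRefl :=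
  fun u w h => by rw [form_comm]; exact h

/-- The real form against a coordinate vector picks out a signed coordinate. [folklore] -/
theorem form_single (v : Fin 22 → ℝ) (j : Fin 22) :
    Matrix.toBilin' (Matrix.diagonal (fun i : Fin 22 => if i.val < 3 then (1 : ℝ) else -1)) v
        (Pi.single j 1) = (if j.val < 3 then (1 : ℝ) else -1) * v j := by
  rw [form_apply]
  rw [Finset.sum_eq_single j]
  · simp
  · intro i _ hij
    simp [hij]
  · intro h; exact absurd (Finset.mem_univ j) h

/-- The real form is nondegenerate. [folklore] -/
theorem form_nondegenerate :
    (Matrix.toBilin' (Matrix.diagonal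
      (fun i : Fin 22 => if i.val < 3 then (1 : ℝ) else -1))).Nondegenerate := by
  have hleft : ∀ v : Fin 22 → ℝ, (∀ w, Matrix.toBilin' (Matrix.diagonal
      (fun i : Fin 22 => if i.val < 3 then (1 : ℝ) else -1)) v w = 0) → v = 0 := by
    intro v hv
    funext j
    have h := hv (Pi.single j 1)
    rw [form_single] at h
    rcases mul_eq_zero.1 h with h | h
    · split_ifs at h <;> norm_num at h
    · simpa using h
  refine ⟨hleft, fun w hw => hleft w fun v => ?_⟩
  rw [form_comm]
  exact hw v

/-- On the `19`-space `{v₀ = v₁ = v₂ = 0}` the real form is `-(Σ_{i≥3} vᵢ²) ≤ 0`, with equality only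
at `0`. [folklore] -/
theorem form_neg_of_head_zero {v : Fin 22 → ℝ} (hv : ∀ i : Fin 22, i.val < 3 → v i = 0)
    (hv0 : v ≠ 0) :
    Matrix.toBilin' (Matrix.diagonal (fun i : Fin 22 => if i.val < 3 then (1 : ℝ) else -1)) v v
      < 0 := by
  rw [form_apply]
  have hterm : ∀ i : Fin 22, (if i.val < 3 then (1 : ℝ) else -1) * v i * v i = -(v i * v i) := by
    intro i
    split_ifs with h
    · rw [hv i h]; ring
    · ring
  simp only [hterm, Finset.sum_neg_distrib, neg_lt_zero]
  obtain ⟨j, hj⟩ : ∃ j, v j ≠ 0 := by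
    by_contra h
    push Not at h
    exact hv0 (funext h)
  exact lt_of_lt_of_le (mul_self_pos.2 hj)
    (Finset.single_le_sum (f := fun i => v i * v i) (fun i _ => mul_self_nonneg (v i))
      (Finset.mem_univ j))

/-- The `19`-space `{v₀ = v₁ = v₂ = 0}` as the kernel of the projection to the first three
coordinates; its dimension is at least `19`. [folklore] -/
theorem finrank_headKer_ge :
    19 ≤ finrank ℝ (LinearMap.ker (LinearMap.pi (fun k : Fin 3 =>
      (LinearMap.proj (Fin.castLE (by norm_num) k) : (Fin 22 → ℝ) →ₗ[ℝ] ℝ)))) := by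
  set f := LinearMap.pi (fun k : Fin 3 =>
      (LinearMap.proj (Fin.castLE (by norm_num) k) : (Fin 22 → ℝ) →ₗ[ℝ] ℝ)) with hf
  have h1 := LinearMap.finrank_range_add_finrank_ker f
  have h2 : finrank ℝ (LinearMap.range f) ≤ 3 := by
    calc finrank ℝ (LinearMap.range f) ≤ finrank ℝ (Fin 3 → ℝ) := Submodule.finrank_le _
      _ = 3 := by simp
  have h3 : finrank ℝ (Fin 22 → ℝ) = 22 := by simp
  omega

/-- Membership in that kernel means the first three coordinates vanish. [folklore] -/
theorem mem_headKer_iff (v : Fin 22 → ℝ) :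
    v ∈ LinearMap.ker (LinearMap.pi (fun k : Fin 3 =>
      (LinearMap.proj (Fin.castLE (by norm_num) k) : (Fin 22 → ℝ) →ₗ[ℝ] ℝ))) ↔
      ∀ i : Fin 22, i.val < 3 → v i = 0 := by
  rw [LinearMap.mem_ker]
  constructor
  · intro h i hi
    have := congrFun h ⟨i.val, hi⟩
    simpa using this
  · intro h
    funext k
    simpa using h (Fin.castLE (by norm_num) k) (by simp)

/-- **The positive index of `D` is `3`**: a subspace on which the real form is non-negative has
dimension at most `3`. [folklore] -/
theorem finrank_le_three_of_nonneg {S : Submodule ℝ (Fin 22 → ℝ)}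
    (hS : ∀ s ∈ S, 0 ≤ Matrix.toBilin' (Matrix.diagonal
      (fun i : Fin 22 => if i.val < 3 then (1 : ℝ) else -1)) s s) :
    finrank ℝ S ≤ 3 := by
  by_contra hlt
  push Not at hlt
  set N := LinearMap.ker (LinearMap.pi (fun k : Fin 3 =>
      (LinearMap.proj (Fin.castLE (by norm_num) k) : (Fin 22 → ℝ) →ₗ[ℝ] ℝ))) with hN
  have hdim := Submodule.finrank_sup_add_finrank_inf_eq S N
  have hle : finrank ℝ ↥(S ⊔ N) ≤ 22 := by
    calc finrank ℝ ↥(S ⊔ N) ≤ finrank ℝ (Fin 22 → ℝ) := Submodule.finrank_le _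
      _ = 22 := by simp
  have h19 := finrank_headKer_ge
  rw [← hN] at h19
  have hpos : 0 < finrank ℝ ↥(S ⊓ N) := by omega
  obtain ⟨⟨z, hz⟩, hz0⟩ := (Module.finrank_pos_iff_exists_ne_zero (R := ℝ)).1 hpos
  have hz0 : z ≠ 0 := fun h => hz0 (Subtype.ext h)
  have hzS : z ∈ S := (Submodule.mem_inf.1 hz).1
  have hzN : z ∈ N := (Submodule.mem_inf.1 hz).2
  have hneg := form_neg_of_head_zero ((mem_headKer_iff z).1 hzN) hz0
  exact absurd (hS z hzS) (not_le.2 hneg)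

/-- **Orthogonal complements of positive `3`-planes are negative definite.** For a `3`-dimensional
subspace `W` of `ℝ²²` on which the real K3 form is positive definite, every non-zero vector of the
`B`-orthogonal complement `Wᗮ` has negative square. [folklore] -/
theorem form_neg_of_mem_orthogonal {W : Submodule ℝ (Fin 22 → ℝ)} (hW3 : finrank ℝ W = 3)
    (hW : ∀ u ∈ W, u ≠ 0 → 0 < Matrix.toBilin' (Matrix.diagonal
      (fun i : Fin 22 => if i.val < 3 then (1 : ℝ) else -1)) u u)
    {u : Fin 22 → ℝ}
    (hu : u ∈ (Matrix.toBilin' (Matrix.diagonal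
      (fun i : Fin 22 => if i.val < 3 then (1 : ℝ) else -1))).orthogonal W) (hu0 : u ≠ 0) :
    Matrix.toBilin' (Matrix.diagonal (fun i : Fin 22 => if i.val < 3 then (1 : ℝ) else -1)) u u
      < 0 := by
  set B := Matrix.toBilin' (Matrix.diagonal (fun i : Fin 22 => if i.val < 3 then (1 : ℝ) else -1))
    with hB
  by_contra hnn
  push Not at hnn
  -- `u ∉ W`
  have huW : u ∉ W := by
    intro huW
    have h1 := hW u huW hu0
    have h2 : B u u = 0 := (LinearMap.BilinForm.mem_orthogonal_iff.1 hu) u huW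
    exact h1.ne' h2
  -- the form is non-negative on `S = W ⊔ ℝu`
  set S := W ⊔ Submodule.span ℝ {u} with hS
  have hnonneg : ∀ s ∈ S, 0 ≤ B s s := by
    intro s hs
    obtain ⟨w, hw, y, hy, rfl⟩ := Submodule.mem_sup.1 hs
    obtain ⟨t, rfl⟩ := Submodule.mem_span_singleton.1 hy
    have hwu : B w u = 0 := (LinearMap.BilinForm.mem_orthogonal_iff.1 hu) w hw
    have hexp : B (w + t • u) (w + t • u) = B w w + t * t * B u u := by
      have : w + t • u = (1 : ℝ) • w + t • u := by rw [one_smul]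
      rw [this, TwinTwistorTransport.MukaiLift.twistorV_comb2 B form_comm, hwu]
      ring
    rw [hexp]
    have h1 : 0 ≤ B w w := by
      by_cases hw0 : w = 0
      · rw [hw0]; simp
      · exact (hW w hw hw0).le
    have h2 : 0 ≤ t * t * B u u := mul_nonneg (mul_self_nonneg t) hnn
    linarith
  -- `dim S = 4`
  have hSdim : finrank ℝ S = 4 := by
    have hdisj : Disjoint W (Submodule.span ℝ {u}) := by
      rw [Submodule.disjoint_span_singleton']
      · exact huW
      · exact hu0
    have h := Submodule.finrank_sup_add_finrank_inf_eq W (Submodule.span ℝ {u})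
    rw [hdisj.eq_bot, finrank_bot, add_zero, hW3, finrank_span_singleton hu0] at h
    rw [hS]
    omega
  have := finrank_le_three_of_nonneg hnonneg
  omega

/-! ### Complements of positive `3`-planes and the transfer map `W₀ → W₁` -/

/-- The orthogonal complement of a `3`-plane has dimension `19`. [folklore] -/
theorem finrank_orthogonal_eq {W : Submodule ℝ (Fin 22 → ℝ)} (hW3 : finrank ℝ W = 3) :
    finrank ℝ ((Matrix.toBilin' (Matrix.diagonal
      (fun i : Fin 22 => if i.val < 3 then (1 : ℝ) else -1))).orthogonal W) = 19 := by
  rw [LinearMap.BilinForm.finrank_orthogonal form_nondegenerate W, hW3]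
  simp

/-- **A positive `3`-plane is complementary to the orthogonal complement of any positive
`3`-plane** (positive meets negative definite trivially; dimensions `3 + 19 = 22`). [folklore] -/
theorem isCompl_pos3_orthogonal {W₀ W₁ : Submodule ℝ (Fin 22 → ℝ)} (hW₀3 : finrank ℝ W₀ = 3)
    (hW₀ : ∀ u ∈ W₀, u ≠ 0 → 0 < Matrix.toBilin' (Matrix.diagonal
      (fun i : Fin 22 => if i.val < 3 then (1 : ℝ) else -1)) u u)
    (hW₁3 : finrank ℝ W₁ = 3)
    (hW₁ : ∀ u ∈ W₁, u ≠ 0 → 0 < Matrix.toBilin' (Matrix.diagonal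
      (fun i : Fin 22 => if i.val < 3 then (1 : ℝ) else -1)) u u) :
    IsCompl W₁ ((Matrix.toBilin' (Matrix.diagonal
      (fun i : Fin 22 => if i.val < 3 then (1 : ℝ) else -1))).orthogonal W₀) := by
  set B := Matrix.toBilin' (Matrix.diagonal (fun i : Fin 22 => if i.val < 3 then (1 : ℝ) else -1))
    with hB
  have hdisj : W₁ ⊓ B.orthogonal W₀ = ⊥ := by
    rw [eq_bot_iff]
    intro u hu
    rw [Submodule.mem_bot]
    by_contra hu0
    have h1 := hW₁ u (Submodule.mem_inf.1 hu).1 hu0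
    have h2 := form_neg_of_mem_orthogonal hW₀3 hW₀ (Submodule.mem_inf.1 hu).2 hu0
    exact absurd h1 (not_lt.2 h2.le)
  refine IsCompl.of_eq hdisj (Submodule.eq_top_of_finrank_eq ?_)
  have h := Submodule.finrank_sup_add_finrank_inf_eq W₁ (B.orthogonal W₀)
  rw [hdisj, finrank_bot, add_zero, hW₁3, finrank_orthogonal_eq hW₀3] at h
  rw [h]
  simp

/-- **The transfer map.** For positive `3`-planes `W₀, W₁ ⊂ ℝ²²` there is a linear map `π` of
`ℝ²²` (the projection onto `W₁` along `W₀ᗮ`) with: values in `W₁`; `π v - v ∈ W₀ᗮ`; injective on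
`W₀`; mapping `W₀` onto `W₁`; and `B (π w) (π w) > 0` for `0 ≠ w ∈ W₀`. (Positive `3`-planes are
graphs over each other.) [folklore] -/
theorem exists_transfer {W₀ W₁ : Submodule ℝ (Fin 22 → ℝ)} (hW₀3 : finrank ℝ W₀ = 3)
    (hW₀ : ∀ u ∈ W₀, u ≠ 0 → 0 < Matrix.toBilin' (Matrix.diagonal
      (fun i : Fin 22 => if i.val < 3 then (1 : ℝ) else -1)) u u)
    (hW₁3 : finrank ℝ W₁ = 3)
    (hW₁ : ∀ u ∈ W₁, u ≠ 0 → 0 < Matrix.toBilin' (Matrix.diagonal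
      (fun i : Fin 22 => if i.val < 3 then (1 : ℝ) else -1)) u u) :
    ∃ π : (Fin 22 → ℝ) →ₗ[ℝ] (Fin 22 → ℝ),
      (∀ v, π v ∈ W₁) ∧
      (∀ v, ∀ u ∈ W₀, Matrix.toBilin' (Matrix.diagonal
        (fun i : Fin 22 => if i.val < 3 then (1 : ℝ) else -1)) u (π v - v) = 0) ∧
      (∀ w ∈ W₀, π w = 0 → w = 0) ∧
      (∀ y ∈ W₁, ∃ w ∈ W₀, π w = y) ∧
      (∀ w ∈ W₀, w ≠ 0 → 0 < Matrix.toBilin' (Matrix.diagonal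
        (fun i : Fin 22 => if i.val < 3 then (1 : ℝ) else -1)) (π w) (π w)) := by
  set B := Matrix.toBilin' (Matrix.diagonal (fun i : Fin 22 => if i.val < 3 then (1 : ℝ) else -1))
    with hB
  have hc : IsCompl W₁ (B.orthogonal W₀) := isCompl_pos3_orthogonal hW₀3 hW₀ hW₁3 hW₁
  have hc₀ : IsCompl W₀ (B.orthogonal W₀) := isCompl_orthogonal_of_posDef B form_comm hW₀
  refine ⟨W₁.projection (B.orthogonal W₀) hc, fun v => Submodule.projection_apply_mem hc v,
    ?_, ?_, ?_, ?_⟩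
  · intro v u hu
    have hmem := Submodule.sub_projection_mem hc v
    have h := (LinearMap.BilinForm.mem_orthogonal_iff.1 hmem) u hu
    rw [LinearMap.BilinForm.sub_right] at h ⊢
    linarith
  · intro w hw h0
    rw [Submodule.projection_apply_eq_zero_iff] at h0
    have : w ∈ W₀ ⊓ B.orthogonal W₀ := Submodule.mem_inf.2 ⟨hw, h0⟩
    rw [hc₀.inf_eq_bot, Submodule.mem_bot] at this
    exact this
  · -- surjectivity onto `W₁` from injectivity on `W₀` and equality of dimensions
    intro y hy
    set f : W₀ →ₗ[ℝ] W₁ := (W₁.projectionOnto (B.orthogonal W₀) hc).comp W₀.subtype with hf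
    have hinj : Function.Injective f := by
      intro a b hab
      have h1 : (f a : Fin 22 → ℝ) = f b := by rw [hab]
      simp only [hf, LinearMap.comp_apply, Submodule.subtype_apply,
        Submodule.coe_projectionOnto_apply] at h1
      have hsub : W₁.projection (B.orthogonal W₀) hc ((a : Fin 22 → ℝ) - b) = 0 := by
        rw [map_sub, h1, sub_self]
      rw [Submodule.projection_apply_eq_zero_iff] at hsub
      have hmem : ((a : Fin 22 → ℝ) - b) ∈ W₀ ⊓ B.orthogonal W₀ :=
        Submodule.mem_inf.2 ⟨W₀.sub_mem a.2 b.2, hsub⟩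
      rw [hc₀.inf_eq_bot, Submodule.mem_bot, sub_eq_zero] at hmem
      exact Subtype.ext hmem
    have hsurj : Function.Surjective f :=
      (LinearMap.injective_iff_surjective_of_finrank_eq_finrank (by rw [hW₀3, hW₁3])).1 hinj
    obtain ⟨⟨w, hw⟩, hwy⟩ := hsurj ⟨y, hy⟩
    refine ⟨w, hw, ?_⟩
    have := congrArg Subtype.val hwy
    simpa [hf] using this
  · intro w hw hw0
    apply hW₁ _ (Submodule.projection_apply_mem hc w)
    intro h0
    rw [Submodule.projection_apply_eq_zero_iff] at h0
    have : w ∈ W₀ ⊓ B.orthogonal W₀ := Submodule.mem_inf.2 ⟨hw, h0⟩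
    rw [hc₀.inf_eq_bot, Submodule.mem_bot] at this
    exact hw0 this

end ELineConnR

end Summit.HodgeConjecture.HodgeConjecture.Theorems

end
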